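import Summits.AtomisticToContinuum.HydrodynamicLimit.Theorems.JParityClosureEvenStressEnskogVelocityEquilibrationRung0MaxwellianContinuity
import Summits.AtomisticToContinuum.HydrodynamicLimit.Theorems.JParityClosureEvenStressEnskogOneBodyDeviationRung0Helpers
import Summits.AtomisticToContinuum.HydrodynamicLimit.Theorems.JParityClosureEvenStressEnskogOneBodyDeviationRung0Truncation
import HarnessLib

/-!
# One-body deviation at rung 0 (stub S3b2 `stub_oneBodyDeviationRung0` of the line
# `preshock-kinetic-slaving`, crux `JParityClosure.EvenStressEnskog`, stmt-AtomisticToContinuum-13079)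
# — main file: the pointwise `L¹` smallness of the window deviation

At global equilibrium (constant profiles `a, θ > 0`, `u`; rung-0 local Gibbs law `G_N`) and at ONE
window centre `x`, the window statistic `S(w) = ∫ b_r(y,x) F(v, u_r, θ_r) dμ_w` of a continuous
quadratic-growth test function `F(v, u, θ)` is `L¹(G_N)`-close to its local-Maxwellian prediction
`ρ_r H(u_r, θ_r)`, `H(u', θ') = ∫ F(v, u', θ') M_{1,θ',u'}(v) dv`, GIVEN the rung-0 local statistics
(registered stub S3b1, taken here as the antecedent): `E|S − ρ_r H(u_r, θ_r)| ≤ ε` for `N ≥ N₀`.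

Route.  `D = S − ρ_r H(p_r)`, `p_r = (u_r, θ_r)`, `p⋆ = (u, θ)`:
* on the good event `|ρ_r − 1| + ‖u_r − u‖ + |θ_r − θ| < ι` (`abs_windowDeviation_le_of_near`):
  `D = T₁ + T₂ + T₄` with `T₁ = (N+1)⁻¹Σ bᵢ [F(vᵢ,p_r) − F(vᵢ,p⋆)]`,
  `T₂ = (N+1)⁻¹Σ bᵢ F(vᵢ,p⋆) − ρ_r ∫ F(·,p⋆) dγ`, `T₄ = ρ_r [H(p⋆) − H(p_r)]`
  (`∫ F(·,p⋆) dγ = H(p⋆)`, `integral_localMaxwellian_mul_eq_integral_gaussMeasure`); `|T₄| ≤ 2ε'` by the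
  continuity of `H` at `p⋆` (`continuousAt_integral_mul_localMaxwellian`), `|T₁| ≤ 2ε' + |T_ψ| + 2∫ψ dγ`
  by uniform continuity of `F` on `‖v‖ ≤ L` and the continuous tail weight `ψ = ψ_L`
  (`abs_sub_le_add_velTailWeight`), `T_ψ = ∫ b_r ψ dμ_w − ρ_r ∫ ψ dγ`;
* on the bad event the deterministic envelope `|D| ≤ 2C(3/πr³)(1 + 3 (N+1)⁻¹Σ‖vᵢ‖²)`
  (`abs_windowDeviation_le_velAvg`);
* the `∫⁻` bookkeeping `exists_lintegral_abs_le_of_split` with the antecedent's `E T₂² → 0`,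
  `E T_ψ² → 0` (S3b1 (iv) for `G = F(·,p⋆)` and `G = ψ`), `G_N(Bad) → 0` (S3b1 (v)) and
  `E[((N+1)⁻¹Σ‖vᵢ‖²)²] ≤ K` (S3b1 (ii)); `L` is chosen first with `∫ ψ_L dγ ≤ ε/16`
  (`exists_integral_velTailWeight_le`), then `ε' = ε/32`, then `ι`.

References: H. Spohn, *Large Scale Dynamics of Interacting Particles* (1991), Part I §2.3
(local equilibrium and its law of large numbers).
-/

noncomputable section

open MeasureTheory ProbabilityTheory Filter Set Topology
open scoped ENNReal InnerProductSpace BigOperators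

namespace Summit.AtomisticToContinuum.HydrodynamicLimit.Theorems.EvenStressEnskog

open Literature.Analysis.FluidPDE Literature.MathematicalPhysics.KineticTheory

/-! ## Measurability of the window statistics -/

/-- `w ↦ ∫ b_r G dμ_w − ρ_r(w, x) c` is measurable for continuous `G` (finite empirical sum). [folklore] -/
theorem measurable_windowTest_sub (r : ℝ) (x : T3) {G : V3 → ℝ} (hG : Continuous G) (c : ℝ)
    (N : ℕ) :
    Measurable fun w : Config (N + 1) (Fin 3) T3 =>
      (∫ q, coneKernel r q.1 x * G q.2 ∂(empiricalMeasure w)) - mollDensity r w x * c := by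
  have h : (fun w : Config (N + 1) (Fin 3) T3 =>
      (∫ q, coneKernel r q.1 x * G q.2 ∂(empiricalMeasure w)) - mollDensity r w x * c) =
      fun w => ((N + 1 : ℕ) : ℝ)⁻¹ * ∑ i, coneKernel r (w i).1 x * G (w i).2 -
        mollDensity r w x * c := by
    funext w
    rw [integral_empiricalMeasure]
  rw [h]
  exact (measurable_const.mul (Finset.measurable_sum _ fun i _ =>
    (measurable_coneKernel_comp r (measurable_pi_apply i).fst measurable_const).mul
      (hG.measurable.comp (measurable_pi_apply i).snd))).sub
    ((measurable_mollDensity_comp r measurable_id measurable_const).mul_const _)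

/-- `w ↦ (N+1)⁻¹ Σᵢ ‖vᵢ‖²` is measurable. [folklore] -/
theorem measurable_velAvg (N : ℕ) :
    Measurable fun w : Config (N + 1) (Fin 3) T3 => ((N + 1 : ℕ) : ℝ)⁻¹ * ∑ i, ‖(w i).2‖ ^ 2 :=
  measurable_const.mul (Finset.measurable_sum _ fun i _ => (measurable_pi_apply i).snd.norm.pow_const 2)

/-- The bad event `{ι ≤ |ρ_r − 1| + ‖u_r − u‖ + |θ_r − θ|}` is measurable. [folklore] -/
theorem measurableSet_windowBad (r : ℝ) (x : T3) (u : V3) (θ ι : ℝ) (N : ℕ) :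
    MeasurableSet {w : Config (N + 1) (Fin 3) T3 |
      ι ≤ |mollDensity r w x - 1| + ‖KineticEntropyBalance.uC r w x - u‖ +
        |mollTemperature r w x - θ|} :=
  measurableSet_le measurable_const
    ((((measurable_mollDensity_comp r measurable_id measurable_const).sub_const 1).abs.add
      ((measurable_uC_comp r measurable_id measurable_const).sub_const u).norm).add
      ((measurable_mollTemperature_comp r measurable_id measurable_const).sub_const θ).abs)

/-! ## The deviation on the good event -/

/-- **The deviation near equilibrium.**  If `ρ_r ≤ 2`, `|F(v, u_r, θ_r) − F(v, u, θ)| ≤ ε' + ψ(v)` for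
all `v`, and `|H(u_r, θ_r) − H(u, θ)| ≤ ε'`, then
`|S − ρ_r H(u_r, θ_r)| ≤ 4ε' + 2∫ψ dγ + |T_F| + |T_ψ|` with the centred window tests
`T_G = ∫ b_r G dμ_w − ρ_r ∫ G dγ` of `G = F(·, u, θ)` and `G = ψ` (`γ = N(u, θ id)`,
`∫ F(·,u,θ) dγ = H(u, θ)`). [folklore] -/
theorem abs_windowDeviation_le_of_near {N : ℕ} {r : ℝ} (hr : 0 < r) {F : V3 × V3 × ℝ → ℝ}
    (u : V3) {θ : ℝ} (hθ : 0 < θ) {ε' : ℝ} (ψ : V3 → ℝ) (hψγ : 0 ≤ ∫ v, ψ v ∂gaussMeasure u θ)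
    (w : Config (N + 1) (Fin 3) T3) (x : T3) (hρ2 : mollDensity r w x ≤ 2)
    (hFψ : ∀ v, |F (v, KineticEntropyBalance.uC r w x, mollTemperature r w x) - F (v, u, θ)| ≤
      ε' + ψ v)
    (hH : |(∫ v, F (v, KineticEntropyBalance.uC r w x, mollTemperature r w x) *
        localMaxwellian 1 (mollTemperature r w x) (KineticEntropyBalance.uC r w x) v) -
        ∫ v, F (v, u, θ) * localMaxwellian 1 θ u v| ≤ ε') :
    |(∫ q, coneKernel r q.1 x *
          F (q.2, KineticEntropyBalance.uC r w x, mollTemperature r w x) ∂(empiricalMeasure w)) -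
        mollDensity r w x *
          ∫ v, F (v, KineticEntropyBalance.uC r w x, mollTemperature r w x) *
            localMaxwellian 1 (mollTemperature r w x) (KineticEntropyBalance.uC r w x) v| ≤
      4 * ε' + 2 * (∫ v, ψ v ∂gaussMeasure u θ) +
        |(∫ q, coneKernel r q.1 x * F (q.2, u, θ) ∂(empiricalMeasure w)) -
            mollDensity r w x * ∫ v, F (v, u, θ) ∂gaussMeasure u θ| +
        |(∫ q, coneKernel r q.1 x * ψ q.2 ∂(empiricalMeasure w)) -
            mollDensity r w x * ∫ v, ψ v ∂gaussMeasure u θ| := by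
  have hρ0 : 0 ≤ mollDensity r w x := mollDensity_nonneg_of_pos hr w x
  have hε'0 : 0 ≤ ε' := (abs_nonneg _).trans hH
  have hn : 0 ≤ ((N + 1 : ℕ) : ℝ)⁻¹ := inv_nonneg.2 (Nat.cast_nonneg _)
  -- the Gaussian identity `H(u, θ) = ∫ F(·, u, θ) dγ`
  have hΓ : ∫ v, F (v, u, θ) * localMaxwellian 1 θ u v = ∫ v, F (v, u, θ) ∂gaussMeasure u θ := by
    rw [← integral_localMaxwellian_mul_eq_integral_gaussMeasure hθ u]
    exact integral_congr_ae (ae_of_all _ fun v => mul_comm _ _)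
  -- the truncation term `T₁`
  have hT1 : |(∫ q, coneKernel r q.1 x *
        F (q.2, KineticEntropyBalance.uC r w x, mollTemperature r w x) ∂(empiricalMeasure w)) -
        ∫ q, coneKernel r q.1 x * F (q.2, u, θ) ∂(empiricalMeasure w)| ≤
      ε' * mollDensity r w x + ∫ q, coneKernel r q.1 x * ψ q.2 ∂(empiricalMeasure w) := by
    rw [integral_empiricalMeasure, integral_empiricalMeasure, integral_empiricalMeasure,
      mollDensity_eq_avg, ← mul_sub, ← Finset.sum_sub_distrib]
    simp_rw [← mul_sub]
    exact abs_avg_mul_le_of_abs_le_add hn (fun i => coneKernel r (w i).1 x)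
      (fun i => F ((w i).2, KineticEntropyBalance.uC r w x, mollTemperature r w x) -
        F ((w i).2, u, θ)) (fun i => ψ (w i).2) (fun i => (coneKernel_mem_Icc hr _ _).1)
      fun i => hFψ _
  -- abbreviations
  set ρ := mollDensity r w x
  set S := ∫ q, coneKernel r q.1 x *
    F (q.2, KineticEntropyBalance.uC r w x, mollTemperature r w x) ∂(empiricalMeasure w)
  set AF := ∫ q, coneKernel r q.1 x * F (q.2, u, θ) ∂(empiricalMeasure w)
  set Aψ := ∫ q, coneKernel r q.1 x * ψ q.2 ∂(empiricalMeasure w)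
  set Hpr := ∫ v, F (v, KineticEntropyBalance.uC r w x, mollTemperature r w x) *
    localMaxwellian 1 (mollTemperature r w x) (KineticEntropyBalance.uC r w x) v
  set Hst := ∫ v, F (v, u, θ) * localMaxwellian 1 θ u v
  set Γ := ∫ v, F (v, u, θ) ∂gaussMeasure u θ
  set Γψ := ∫ v, ψ v ∂gaussMeasure u θ
  -- assemble
  have key : S - ρ * Hpr = (S - AF) + (AF - ρ * Γ) + ρ * (Hst - Hpr) := by
    rw [hΓ]
    ring
  have h3 : |ρ * (Hst - Hpr)| ≤ ρ * ε' := by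
    rw [abs_mul, abs_of_nonneg hρ0, abs_sub_comm]
    exact mul_le_mul_of_nonneg_left hH hρ0
  have h4 : Aψ ≤ |Aψ - ρ * Γψ| + 2 * Γψ := by
    have h := le_abs_self (Aψ - ρ * Γψ)
    have h' : ρ * Γψ ≤ 2 * Γψ := mul_le_mul_of_nonneg_right hρ2 hψγ
    linarith
  have h5 : ε' * ρ ≤ ε' * 2 := mul_le_mul_of_nonneg_left hρ2 hε'0
  calc |S - ρ * Hpr| = |(S - AF) + (AF - ρ * Γ) + ρ * (Hst - Hpr)| := by rw [key]
    _ ≤ |S - AF| + |AF - ρ * Γ| + |ρ * (Hst - Hpr)| := abs_add_three _ _ _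
    _ ≤ 4 * ε' + 2 * Γψ + |AF - ρ * Γ| + |Aψ - ρ * Γψ| := by linarith

/-! ## The registered stub -/

/-- **S3b2 · One-body deviation at rung 0** (registered stub `stub_oneBodyDeviationRung0` of the
line `preshock-kinetic-slaving`).  GIVEN the rung-0 local statistics at a window centre (the text
of the registered stub S3b1: probability of `G_N`, velocity moment bounds, `E(ρ_r − 1)² → 0`,
`E(∫ b_r G dμ_w − ρ_r ∫ G dγ)² → 0` for continuous quadratic-growth `G`, and concentration of
`(ρ_r, u_r, θ_r)`), for constant profiles `a, θ > 0`, `u`, small `σ`, every flow family, every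
continuous `F` with `|F(v,u',θ')| ≤ C(1 + ‖v‖² + ‖u'‖² + |θ'|)`, `0 < r < 1/2`, `x` and `ε > 0`:
`∫⁻ |∫ b_r F(v, u_r, θ_r) dμ_w − ρ_r ∫ F(v, u_r, θ_r) M_{1,θ_r,u_r}(v) dv| dG_N ≤ ε` for all
large `N` (Spohn 1991, Part I §2.3: the local equilibrium law of large numbers, one-body
statistics at a point). [folklore] -/
theorem stub_oneBodyDeviationRung0 :
    (∀ (a θ : ℝ) (u : V3), 0 < a → 0 < θ → ∃ σ₀ : ℝ, 0 < σ₀ ∧ ∀ σ : ℝ, 0 < σ → σ < σ₀ →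
    ∀ Φ : (N : ℕ) → HardSphereFlow (Torus.geometry (Fin 3)) (hsDiameter σ N) (N + 1),
    (∀ N, IsProbabilityMeasure (localGibbsLaw σ (fun _ => a) (fun _ => u) (fun _ => θ) N (Φ N))) ∧
    (∃ K : ℝ, ∀ N : ℕ,
      ∫⁻ w, ENNReal.ofReal (((N + 1 : ℕ) : ℝ)⁻¹ * ∑ i, ‖(w i).2‖ ^ 2)
          ∂(localGibbsLaw σ (fun _ => a) (fun _ => u) (fun _ => θ) N (Φ N)) ≤ ENNReal.ofReal K ∧
      ∫⁻ w, ENNReal.ofReal ((((N + 1 : ℕ) : ℝ)⁻¹ * ∑ i, ‖(w i).2‖ ^ 2) ^ 2)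
          ∂(localGibbsLaw σ (fun _ => a) (fun _ => u) (fun _ => θ) N (Φ N)) ≤ ENNReal.ofReal K) ∧
    ∀ r : ℝ, 0 < r → r < 1 / 2 → ∀ x : T3,
      Tendsto (fun N : ℕ => ∫⁻ w, ENNReal.ofReal ((mollDensity r w x - 1) ^ 2)
        ∂(localGibbsLaw σ (fun _ => a) (fun _ => u) (fun _ => θ) N (Φ N))) atTop (𝓝 0) ∧
      (∀ G : V3 → ℝ, Continuous G → (∃ C : ℝ, ∀ v, |G v| ≤ C * (1 + ‖v‖ ^ 2)) →
        Tendsto (fun N : ℕ => ∫⁻ w, ENNReal.ofReal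
            (((∫ q, coneKernel r q.1 x * G q.2 ∂(empiricalMeasure w)) -
              mollDensity r w x * ∫ v, G v ∂(gaussMeasure u θ)) ^ 2)
          ∂(localGibbsLaw σ (fun _ => a) (fun _ => u) (fun _ => θ) N (Φ N))) atTop (𝓝 0)) ∧
      ∀ ι : ℝ, 0 < ι →
        Tendsto (fun N : ℕ => localGibbsLaw σ (fun _ => a) (fun _ => u) (fun _ => θ) N (Φ N)
          {w | ι ≤ |mollDensity r w x - 1| + ‖KineticEntropyBalance.uC r w x - u‖ +
            |mollTemperature r w x - θ|}) atTop (𝓝 0)) →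
    ∀ (a θ : ℝ) (u : V3), 0 < a → 0 < θ → ∃ σ₀ : ℝ, 0 < σ₀ ∧ ∀ σ : ℝ, 0 < σ → σ < σ₀ →
    ∀ Φ : (N : ℕ) → HardSphereFlow (Torus.geometry (Fin 3)) (hsDiameter σ N) (N + 1),
    ∀ F : V3 × V3 × ℝ → ℝ, Continuous F →
    (∃ C : ℝ, ∀ q, |F q| ≤ C * (1 + ‖q.1‖ ^ 2 + ‖q.2.1‖ ^ 2 + |q.2.2|)) →
    ∀ r : ℝ, 0 < r → r < 1 / 2 → ∀ x : T3, ∀ ε : ℝ, 0 < ε → ∃ N₀ : ℕ, ∀ N : ℕ, N₀ ≤ N →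
      ∫⁻ w, ENNReal.ofReal
          |(∫ q, coneKernel r q.1 x *
                F (q.2, KineticEntropyBalance.uC r w x, mollTemperature r w x) ∂(empiricalMeasure w)) -
            mollDensity r w x *
              ∫ v, F (v, KineticEntropyBalance.uC r w x, mollTemperature r w x) *
                localMaxwellian 1 (mollTemperature r w x) (KineticEntropyBalance.uC r w x) v|
        ∂(localGibbsLaw σ (fun _ => a) (fun _ => u) (fun _ => θ) N (Φ N)) ≤ ENNReal.ofReal ε := by
  intro hS3b1 a θ u ha hθ
  obtain ⟨σ₀, hσ₀, hS⟩ := hS3b1 a θ u ha hθ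
  refine ⟨σ₀, hσ₀, fun σ hσ hσlt Φ F hF hCF r hr hr2 x ε hε => ?_⟩
  obtain ⟨hprob, ⟨K, hK⟩, hloc⟩ := hS σ hσ hσlt Φ
  obtain ⟨-, hvel, hconc⟩ := hloc r hr hr2 x
  obtain ⟨C, hC⟩ := hCF
  have hC0 : 0 ≤ C := quadGrowthConst_nonneg hC
  -- Step 1: the truncation radius `L` and the tail weight `ψ`
  set cst : ℝ := (‖u‖ + 1) ^ 2 + (|θ| + 1) + ‖u‖ ^ 2 + |θ|
  have hcst0 : 0 ≤ cst := by positivity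
  obtain ⟨M, hM0, hM⟩ := exists_integral_velTailWeight_le hC0 hcst0 u θ
  set L : ℝ := Real.sqrt (16 * M / ε + 1)
  have hL0 : 0 < L := Real.sqrt_pos.2 (by positivity)
  have hL2 : L ^ 2 = 16 * M / ε + 1 := Real.sq_sqrt (by positivity)
  have hεL : ε * L ^ 2 = 16 * M + ε := by
    rw [hL2]
    field_simp
  set ψ : V3 → ℝ := fun v => C * (2 + 2 * ‖v‖ ^ 2 + cst) * min 1 (‖v‖ ^ 2 / L ^ 2)
  have hψc : Continuous ψ := continuous_velTailWeight C cst L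
  have hψb : ∃ C' : ℝ, ∀ v, |ψ v| ≤ C' * (1 + ‖v‖ ^ 2) :=
    ⟨C * (2 + cst), fun v => abs_velTailWeight_le hC0 hcst0 L v⟩
  have hψγ : ∫ v, ψ v ∂gaussMeasure u θ ≤ ε / 16 := by
    refine (hM L hL0).trans ?_
    rw [div_le_div_iff₀ (by positivity) (by positivity)]
    nlinarith [hεL]
  have hψγ0 : 0 ≤ ∫ v, ψ v ∂gaussMeasure u θ :=
    integral_nonneg fun v => velTailWeight_nonneg hC0 hcst0 L v
  -- Step 2: `ε'` and the two continuity moduli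
  set ε' : ℝ := ε / 32 with hε'
  have hε'0 : 0 < ε' := by positivity
  obtain ⟨ιF, hιF, hιF1, hmodF⟩ := exists_uniformModulus_prod hF L (u, θ) hε'0
  obtain ⟨ιH, hιH, hmodH⟩ := Metric.continuousAt_iff.1
    (continuousAt_integral_mul_localMaxwellian hF ⟨C, hC⟩ u hθ) ε' hε'0
  set ι : ℝ := min ιF ιH
  have hι0 : 0 < ι := lt_min hιF hιH
  have hι1 : ι ≤ 1 := (min_le_left _ _).trans hιF1
  -- Step 3: the fixed velocity test `G = F(·, u, θ)`
  have hGc : Continuous fun v : V3 => F (v, u, θ) :=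
    hF.comp (continuous_id.prodMk continuous_const)
  have hGb : ∃ C' : ℝ, ∀ v : V3, |F (v, u, θ)| ≤ C' * (1 + ‖v‖ ^ 2) := by
    refine ⟨C * (1 + ‖u‖ ^ 2 + |θ|), fun v => (hC (v, u, θ)).trans ?_⟩
    have h : (1 : ℝ) + ‖v‖ ^ 2 + ‖u‖ ^ 2 + |θ| ≤ (1 + ‖u‖ ^ 2 + |θ|) * (1 + ‖v‖ ^ 2) := by
      nlinarith [sq_nonneg ‖v‖, sq_nonneg ‖u‖, abs_nonneg θ, mul_nonneg (sq_nonneg ‖u‖) (sq_nonneg ‖v‖),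
        mul_nonneg (abs_nonneg θ) (sq_nonneg ‖v‖)]
    calc C * (1 + ‖v‖ ^ 2 + ‖u‖ ^ 2 + |θ|) ≤ C * ((1 + ‖u‖ ^ 2 + |θ|) * (1 + ‖v‖ ^ 2)) :=
          mul_le_mul_of_nonneg_left h hC0
      _ = C * (1 + ‖u‖ ^ 2 + |θ|) * (1 + ‖v‖ ^ 2) := by ring
  -- Step 4: the pointwise split
  have hc₀ : 0 ≤ 4 * ε' + 2 * ∫ v, ψ v ∂gaussMeasure u θ := by linarith
  have hD : ∀ (N : ℕ) (w : Config (N + 1) (Fin 3) T3),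
      |(∫ q, coneKernel r q.1 x *
            F (q.2, KineticEntropyBalance.uC r w x, mollTemperature r w x) ∂(empiricalMeasure w)) -
          mollDensity r w x *
            ∫ v, F (v, KineticEntropyBalance.uC r w x, mollTemperature r w x) *
              localMaxwellian 1 (mollTemperature r w x) (KineticEntropyBalance.uC r w x) v| ≤
        (4 * ε' + 2 * ∫ v, ψ v ∂gaussMeasure u θ) +
          |(∫ q, coneKernel r q.1 x * F (q.2, u, θ) ∂(empiricalMeasure w)) -
              mollDensity r w x * ∫ v, F (v, u, θ) ∂gaussMeasure u θ| +
          |(∫ q, coneKernel r q.1 x * ψ q.2 ∂(empiricalMeasure w)) -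
              mollDensity r w x * ∫ v, ψ v ∂gaussMeasure u θ| +
          {w : Config (N + 1) (Fin 3) T3 | ι ≤ |mollDensity r w x - 1| +
              ‖KineticEntropyBalance.uC r w x - u‖ + |mollTemperature r w x - θ|}.indicator
            (fun w => 2 * C * (3 / (Real.pi * r ^ 3)) +
              6 * C * (3 / (Real.pi * r ^ 3)) * (((N + 1 : ℕ) : ℝ)⁻¹ * ∑ i, ‖(w i).2‖ ^ 2)) w := by
    intro N w
    by_cases hbad : w ∈ {w : Config (N + 1) (Fin 3) T3 | ι ≤ |mollDensity r w x - 1| +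
        ‖KineticEntropyBalance.uC r w x - u‖ + |mollTemperature r w x - θ|}
    · rw [indicator_of_mem hbad]
      refine (abs_windowDeviation_le_velAvg hr hC w x).trans (le_add_of_nonneg_left ?_)
      exact add_nonneg (add_nonneg hc₀ (abs_nonneg _)) (abs_nonneg _)
    · rw [indicator_of_notMem hbad, add_zero]
      have hgood : |mollDensity r w x - 1| + ‖KineticEntropyBalance.uC r w x - u‖ +
          |mollTemperature r w x - θ| < ι := not_le.1 hbad
      have ha1 := abs_nonneg (mollDensity r w x - 1)
      have ha2 := norm_nonneg (KineticEntropyBalance.uC r w x - u)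
      have ha3 := abs_nonneg (mollTemperature r w x - θ)
      have hdist : dist (KineticEntropyBalance.uC r w x, mollTemperature r w x) (u, θ) < ι := by
        rw [Prod.dist_eq, dist_eq_norm, Real.dist_eq]
        exact max_lt (by linarith) (by linarith)
      have hρ2 : mollDensity r w x ≤ 2 := by
        have h := (abs_lt.1 (show |mollDensity r w x - 1| < ι by linarith)).2
        linarith
      have hu' : ‖KineticEntropyBalance.uC r w x‖ ≤ ‖u‖ + 1 := by
        have h : ‖KineticEntropyBalance.uC r w x‖ ≤ ‖KineticEntropyBalance.uC r w x - u‖ + ‖u‖ := by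
          calc ‖KineticEntropyBalance.uC r w x‖ = ‖(KineticEntropyBalance.uC r w x - u) + u‖ := by
                rw [sub_add_cancel]
            _ ≤ ‖KineticEntropyBalance.uC r w x - u‖ + ‖u‖ := norm_add_le _ _
        linarith
      have hθ' : |mollTemperature r w x| ≤ |θ| + 1 := by
        have h : |mollTemperature r w x| ≤ |mollTemperature r w x - θ| + |θ| := by
          calc |mollTemperature r w x| = |(mollTemperature r w x - θ) + θ| := by rw [sub_add_cancel]
            _ ≤ |mollTemperature r w x - θ| + |θ| := abs_add_le _ _
        linarith
      have hFψ : ∀ v, |F (v, KineticEntropyBalance.uC r w x, mollTemperature r w x) - F (v, u, θ)| ≤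
          ε' + ψ v :=
        abs_sub_le_add_velTailWeight hC hC0 hL0 hε'0.le hu' hθ' fun v hv =>
          hmodF v hv (KineticEntropyBalance.uC r w x, mollTemperature r w x)
            (hdist.trans_le (min_le_left _ _))
      have hH : |(∫ v, F (v, KineticEntropyBalance.uC r w x, mollTemperature r w x) *
          localMaxwellian 1 (mollTemperature r w x) (KineticEntropyBalance.uC r w x) v) -
          ∫ v, F (v, u, θ) * localMaxwellian 1 θ u v| ≤ ε' := by
        have h := hmodH (hdist.trans_le (min_le_right _ _))
        dsimp only at h
        rw [Real.dist_eq] at h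
        exact h.le
      exact abs_windowDeviation_le_of_near hr u hθ ψ hψγ0 w x hρ2 hFψ hH
  -- Step 5: the inputs of the bookkeeping lemma, in beta-reduced form
  have hTlim : Tendsto (fun N : ℕ => ∫⁻ w, ENNReal.ofReal
      (((∫ q, coneKernel r q.1 x * F (q.2, u, θ) ∂(empiricalMeasure w)) -
        mollDensity r w x * ∫ v, F (v, u, θ) ∂gaussMeasure u θ) ^ 2)
      ∂(localGibbsLaw σ (fun _ => a) (fun _ => u) (fun _ => θ) N (Φ N))) atTop (𝓝 0) :=
    hvel (fun v => F (v, u, θ)) hGc hGb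
  have hTψlim : Tendsto (fun N : ℕ => ∫⁻ w, ENNReal.ofReal
      (((∫ q, coneKernel r q.1 x * ψ q.2 ∂(empiricalMeasure w)) -
        mollDensity r w x * ∫ v, ψ v ∂gaussMeasure u θ) ^ 2)
      ∂(localGibbsLaw σ (fun _ => a) (fun _ => u) (fun _ => θ) N (Φ N))) atTop (𝓝 0) :=
    hvel ψ hψc hψb
  have hVK : ∀ N : ℕ, ∫⁻ w, ENNReal.ofReal ((((N + 1 : ℕ) : ℝ)⁻¹ * ∑ i, ‖(w i).2‖ ^ 2) ^ 2)
      ∂(localGibbsLaw σ (fun _ => a) (fun _ => u) (fun _ => θ) N (Φ N)) ≤ ENNReal.ofReal (max K 0) :=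
    fun N => (hK N).2.trans (ENNReal.ofReal_le_ofReal (le_max_left _ _))
  have hTm : ∀ N : ℕ, Measurable fun w : Config (N + 1) (Fin 3) T3 =>
      (∫ q, coneKernel r q.1 x * F (q.2, u, θ) ∂(empiricalMeasure w)) -
        mollDensity r w x * ∫ v, F (v, u, θ) ∂gaussMeasure u θ :=
    fun N => measurable_windowTest_sub r x (G := fun v => F (v, u, θ)) hGc _ N
  have hTψm : ∀ N : ℕ, Measurable fun w : Config (N + 1) (Fin 3) T3 =>
      (∫ q, coneKernel r q.1 x * ψ q.2 ∂(empiricalMeasure w)) -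
        mollDensity r w x * ∫ v, ψ v ∂gaussMeasure u θ :=
    fun N => measurable_windowTest_sub r x (G := ψ) hψc _ N
  -- Step 6: the `∫⁻` bookkeeping
  obtain ⟨N₀, hN₀⟩ := @exists_lintegral_abs_le_of_split (fun N => Config (N + 1) (Fin 3) T3) _
    (fun N => localGibbsLaw σ (fun _ => a) (fun _ => u) (fun _ => θ) N (Φ N)) hprob
    (fun N w => (∫ q, coneKernel r q.1 x *
          F (q.2, KineticEntropyBalance.uC r w x, mollTemperature r w x) ∂(empiricalMeasure w)) -
        mollDensity r w x *
          ∫ v, F (v, KineticEntropyBalance.uC r w x, mollTemperature r w x) *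
            localMaxwellian 1 (mollTemperature r w x) (KineticEntropyBalance.uC r w x) v)
    (fun N w => (∫ q, coneKernel r q.1 x * F (q.2, u, θ) ∂(empiricalMeasure w)) -
        mollDensity r w x * ∫ v, F (v, u, θ) ∂gaussMeasure u θ)
    (fun N w => (∫ q, coneKernel r q.1 x * ψ q.2 ∂(empiricalMeasure w)) -
        mollDensity r w x * ∫ v, ψ v ∂gaussMeasure u θ)
    (fun N w => ((N + 1 : ℕ) : ℝ)⁻¹ * ∑ i, ‖(w i).2‖ ^ 2)
    (fun N => {w : Config (N + 1) (Fin 3) T3 | ι ≤ |mollDensity r w x - 1| +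
        ‖KineticEntropyBalance.uC r w x - u‖ + |mollTemperature r w x - θ|})
    hTm hTψm measurable_velAvg (measurableSet_windowBad r x u θ ι)
    (4 * ε' + 2 * ∫ v, ψ v ∂gaussMeasure u θ) (2 * C * (3 / (Real.pi * r ^ 3)))
    (6 * C * (3 / (Real.pi * r ^ 3))) (max K 0) hc₀ (by positivity) (by positivity)
    (le_max_right _ _) hD hTlim hTψlim (hconc ι hι0) hVK (ε / 2) (by positivity)
  refine ⟨N₀, fun N hN => (hN₀ N hN).trans (ENNReal.ofReal_le_ofReal ?_)⟩
  rw [hε']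
  linarith

end Summit.AtomisticToContinuum.HydrodynamicLimit.Theorems.EvenStressEnskog

end
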